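import Mathlib
import Summits.KontsevichZagierPeriods.Zeta5Search.Families.DualConstantTermSum
import Summits.KontsevichZagierPeriods.Zeta5Search.DexactDiagonalWhipple
import HarnessLib

/-!
# ζ(5) search — Families: a SECOND closed form of the coefficients of the dual span product (a DOUBLE binomial
# sum), and the BRIDGE `dualConstantTerm (n·1⁸) = Fdiag n` (D-exact on the whole diagonal ⟸ the single-sum identity K1)

HONEST FRAMING: systematic search; no irrationality claim unless certified.  Cell `pub-zeta5`, family designer
`fam-tele` (creative telescoping / recurrences), gen 11, 2026-08-21.  Identities between integers only (coefficients
of a polynomial with non-negative integer coefficients, finite binomial sums); nothing about the arithmetic of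
`ζ(5)`; no number of record moves; no conjecture node is used as a hypothesis or asserted.

CONTEXT.  `Families/DualSpanProdCoeff` (cert-2 g7) computes every coefficient `[g^m] dualSpanProd A` of P2 g6's
dual span product (`Families/DualConstantTerm`) as the 3-fold sum `DualCT.ctSum A m`, by three binomial splits and
the extraction order `g₀, g₁, g₅, g₄, g₃ | g₂`; `Families/DualConstantTermSum` specialises it to the diagonal
(`dualConstantTerm_diag`, a triple sum) and reduces D-exact on the diagonal to ONE order-3 recurrence for that
triple sum (`dexact_diag_of_solvesRec`).  Here the SAME generic extraction lemmas are run in a second order —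
TWO binomial splits (`(g₀+g₁+g₂+g₃)^{A₆}` along `(g₀+g₁+g₂) | g₃`, `(g₁+⋯+g₅)^{A₁}` along `g₁ | (g₂+⋯+g₅)`) and the
extractions `g₀, g₁, g₅, g₂, g₄ | g₃` — which is the expansion order of the pen-and-paper note
`HOME/pub-zeta5-fam-tele/g10/DEXACT-DIAGONAL-PROOF.md` (Theorem 1 there; [MOS20, §3.2]-style).

CONTENTS (standard axioms only; namespace `…Families.Cellular`, generic part in `DualCT`):
* `DualCT.term₂`, `dualSpanProd_eq_sum₂`, `termCoeff₂`, `coeff_term₂`, `ctSum₂`,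
  **`coeff_dualSpanProd₂ : [g^m] dualSpanProd A = ctSum₂ A m`** — a 2-fold sum of products of seven binomial
  coefficients (three guards), for EVERY exponent vector `A` and monomial `m`;
* **`ctSum_eq_ctSum₂`** — cert-2's 3-fold sum equals the 2-fold sum identically in `(A, m)` (two extraction orders of
  one coefficient; on the diagonal the two sums agree after grouping by the index of the common split
  `(g₁+⋯+g₅)^{A₁}`, NOT termwise);
* `dualConstantTerm_diag₂` — **on the diagonal the torus period is the clean DOUBLE sum**
  `Σ_{k₁+k₂≤n} C(n,k₁)C(n+k₁,n)²·C(n,k₂)C(n+k₁,n−k₂)C(2n−k₂,n)C(2n−k₂,n−k₁−k₂)` (`= Fdiag n`: `1, 21, 2989, 714549,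
  217515501, 76157194521, …`), and the decided instances `n = 4, 5` of D-exact (`|Q(n·1⁸)| = dualConstantTerm (n·1⁸)`;
  `n ≤ 3` are in `DualConstantTermSum`);
* **`dualConstantTerm_diag_eq_Fdiag : dualConstantTerm (n·1⁸) = Fdiag n`** — THE BRIDGE to fam-tele g10's
  `Zeta5Search/DexactDiagonalWhipple` (`SA`, `SB`, `Fdiag`, the open node `SingleSumIdentity` =
  `C(n+k,n)·SA n k = C(n,k)·SB n k` for `k ≤ n`, and `Fdiag_eq_of_singleSum : SingleSumIdentity → Fdiag n = Q n`),
  hence **`dexact_diag_of_singleSum : SingleSumIdentity → ∀ n, |Q(n·1⁸)| = dualConstantTerm (n·1⁸)`** — D-exact on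
  the WHOLE diagonal follows from ONE identity between two SINGLE binomial sums.  That identity is a terminating
  balanced `₄F₃(1)` transformation of Whipple type [Andrews–Askey–Roy, *Special Functions*, Thm 3.3.3; Whipple
  1926]; its kernel proof is a certificate replay (fam-tele g10 `k1cert/`, engines REQUESTS L2146/L2148/L2149;
  fam-tele g11 `DexactDiagonalSingleSum.lean` / P2 g6 `DexactDiagonalK1Rec` + sequel) and is NOT part of this
  file, which uses `SingleSumIdentity` only as an explicit hypothesis `(h : SingleSumIdentity)`.
Exact cross-checks outside the kernel (seat folder `bridge/`): `ctSum₂ = ctSum =` brute-force coefficient on 300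
random `(A, m)`; diagonal values `n ≤ 8`; the grouping statement for `n ≤ 8`.
-/

noncomputable section

open MvPolynomial Finset

namespace Summit.KontsevichZagierPeriods.Zeta5Search.Families.Cellular

open Literature.NumberTheory.Irrationality

namespace DualCT

open Summit.KontsevichZagierPeriods.Zeta5Search.DexactDiagonalWhipple
  (SA SB Fdiag SingleSumIdentity Fdiag_eq_of_singleSum)

/-! ## The second extraction order: two splits, extract `g₀, g₁, g₅, g₂, g₄`, read off `g₃` -/

/-- The summand of `dualSpanProd A` after the TWO binomial splits `(g₀+g₁+g₂+g₃)^{A₆} = ((g₀+g₁+g₂) + g₃)^{A₆}`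
(index `k₁` = exponent of `g₀+g₁+g₂`) and `(g₁+⋯+g₅)^{A₁} = (g₁ + (g₂+⋯+g₅))^{A₁}` (index `k₂` = exponent of `g₁`). -/
def term₂ (A : Fin 8 → ℕ) (k₁ k₂ : ℕ) : P6 :=
  (X 0 + (X 1 + X 2)) ^ (k₁ + A 7) * ((X 1 + X 2) ^ A 0 * (X 1 ^ k₂ * (X 3 ^ (A 6 - k₁) *
    ((X 2 + X 3 + X 4 + X 5) ^ (A 1 - k₂ + A 2) * (X 2 + X 3 + X 4) ^ A 3))))

/-- STEP 1′: `dualSpanProd A = Σ_{k₁ ≤ A₆} Σ_{k₂ ≤ A₁} C(A₆,k₁)C(A₁,k₂) · term₂ A k₁ k₂` (binomial theorem twice). -/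
theorem dualSpanProd_eq_sum₂ (A : Fin 8 → ℕ) :
    dualSpanProd A = ∑ k₁ ∈ range (A 6 + 1), ∑ k₂ ∈ range (A 1 + 1),
      C ((A 6).choose k₁ * (A 1).choose k₂ : ℤ) * term₂ A k₁ k₂ := by
  have h6 : (X 0 + X 1 + X 2 + X 3 : P6) ^ A 6 =
      ∑ k₁ ∈ range (A 6 + 1), (X 0 + X 1 + X 2) ^ k₁ * X 3 ^ (A 6 - k₁) * ((A 6).choose k₁ : P6) := by
    rw [add_pow]
  have h1 : (X 1 + X 2 + X 3 + X 4 + X 5 : P6) ^ A 1 =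
      ∑ k₂ ∈ range (A 1 + 1), X 1 ^ k₂ * (X 2 + X 3 + X 4 + X 5) ^ (A 1 - k₂) * ((A 1).choose k₂ : P6) := by
    rw [show (X 1 + X 2 + X 3 + X 4 + X 5 : P6) = X 1 + (X 2 + X 3 + X 4 + X 5) by ring, add_pow]
  have e : dualSpanProd A = (X 0 + X 1 + X 2 + X 3 : P6) ^ A 6 * ((X 1 + X 2 + X 3 + X 4 + X 5 : P6) ^ A 1 *
      ((X 1 + X 2) ^ A 0 * (X 2 + X 3 + X 4 + X 5) ^ A 2 * (X 2 + X 3 + X 4) ^ A 3 * (X 0 + X 1 + X 2) ^ A 7)) := by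
    unfold dualSpanProd; ring
  rw [e, h6, h1]
  simp only [Finset.sum_mul, Finset.mul_sum]
  rw [Finset.sum_comm]
  refine Finset.sum_congr rfl fun k₁ _ => Finset.sum_congr rfl fun k₂ _ => ?_
  unfold term₂
  simp only [← C_eq_coe_nat, map_mul]
  ring

/-- The multi-index left after erasing the slots `0, 1, 5, 2, 4` is `(m 3)·e₃`. -/
theorem idx_eq₂ (m : Fin 6 →₀ ℕ) :
    ((((m.erase 0).erase 1).erase 5).erase 2).erase 4 = Finsupp.single 3 (m 3) := by
  ext w
  fin_cases w <;> simp

/-- The coefficient of `g^m` in `term₂ A k₁ k₂`: five binomial coefficients and three guards (the `g₁`-budget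
`k₂ ≤ m₁`, the `g₂`-budget, and the forced `g₃`-exponent).  With `U = k₁+A₇−m₀+A₀` (exponent of `g₁+g₂` after the
`g₀`-extraction), `V = A₁−k₂+A₂−m₅+A₃` (exponent of `g₂+g₃+g₄` after the `g₅`-extraction) and
`W = V − (m₂ − (U − (m₁−k₂)))` (exponent of `g₃+g₄` after the `g₂`-extraction) it reads
`C(k₁+A₇,m₀)·C(U,m₁−k₂)·C(A₁−k₂+A₂,m₅)·C(V,m₂−(U−(m₁−k₂)))·C(W,m₄)·[W−m₄+(A₆−k₁) = m₃]`. -/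
def termCoeff₂ (A : Fin 8 → ℕ) (m : Fin 6 → ℕ) (k₁ k₂ : ℕ) : ℤ :=
  ((k₁ + A 7).choose (m 0) : ℤ) *
    (if k₂ ≤ m 1 then
      ((k₁ + A 7 - m 0 + A 0).choose (m 1 - k₂) : ℤ) *
        (((A 1 - k₂ + A 2).choose (m 5) : ℤ) *
          (if k₁ + A 7 - m 0 + A 0 - (m 1 - k₂) ≤ m 2 then
            ((A 1 - k₂ + A 2 - m 5 + A 3).choose (m 2 - (k₁ + A 7 - m 0 + A 0 - (m 1 - k₂))) : ℤ) *
              (((A 1 - k₂ + A 2 - m 5 + A 3 - (m 2 - (k₁ + A 7 - m 0 + A 0 - (m 1 - k₂)))).choose (m 4) : ℤ) *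
                (if A 1 - k₂ + A 2 - m 5 + A 3 - (m 2 - (k₁ + A 7 - m 0 + A 0 - (m 1 - k₂))) - m 4 + (A 6 - k₁)
                      = m 3 then 1 else 0))
          else 0))
    else 0)

/-- STEP 2′: `[m] term₂ A k₁ k₂ = termCoeff₂ A m k₁ k₂` — extract `g₀, g₁, g₅, g₂, g₄`, then read off `g₃`. -/
theorem coeff_term₂ (A : Fin 8 → ℕ) (k₁ k₂ : ℕ) (m : Fin 6 →₀ ℕ) :
    coeff m (term₂ A k₁ k₂) = termCoeff₂ A m k₁ k₂ := by
  unfold term₂ termCoeff₂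
  rw [coeff_X_add_pow_mul (0 : Fin 6) ?_ ?_]
  rotate_left
  · repeat (first
      | with_reducible exact (notMem_vars_X_and (by decide)).1
      | with_reducible apply notMem_vars_mul
      | with_reducible refine (notMem_vars_pow_and ?_ _).1
      | with_reducible apply notMem_vars_add)
  · repeat (first
      | with_reducible exact (notMem_vars_X_and (by decide)).1
      | with_reducible apply notMem_vars_mul
      | with_reducible refine (notMem_vars_pow_and ?_ _).1
      | with_reducible apply notMem_vars_add)
  congr 1
  rw [show ((X 1 + X 2) ^ (k₁ + A 7 - m 0) * ((X 1 + X 2) ^ A 0 * (X 1 ^ k₂ * (X 3 ^ (A 6 - k₁) *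
      ((X 2 + X 3 + X 4 + X 5) ^ (A 1 - k₂ + A 2) * (X 2 + X 3 + X 4) ^ A 3)))) : P6)
      = X 1 ^ k₂ * ((X 1 + X 2) ^ (k₁ + A 7 - m 0 + A 0) * (X 3 ^ (A 6 - k₁) *
      ((X 2 + X 3 + X 4 + X 5) ^ (A 1 - k₂ + A 2) * (X 2 + X 3 + X 4) ^ A 3))) by ring]
  rw [coeff_X_pow_mul_X_add_pow_mul (1 : Fin 6) ?_ ?_]
  rotate_left
  · repeat (first
      | with_reducible exact (notMem_vars_X_and (by decide)).1
      | with_reducible apply notMem_vars_mul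
      | with_reducible refine (notMem_vars_pow_and ?_ _).1
      | with_reducible apply notMem_vars_add)
  · repeat (first
      | with_reducible exact (notMem_vars_X_and (by decide)).1
      | with_reducible apply notMem_vars_mul
      | with_reducible refine (notMem_vars_pow_and ?_ _).1
      | with_reducible apply notMem_vars_add)
  have hm1 : (m.erase 0) 1 = m 1 := Finsupp.erase_ne (by decide)
  rw [hm1]
  by_cases hc : k₂ ≤ m 1
  · rw [if_pos hc, if_pos hc]
    congr 1
    set U := k₁ + A 7 - m 0 + A 0 with hU
    rw [show (X 2 ^ (U - (m 1 - k₂)) * (X 3 ^ (A 6 - k₁) *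
        ((X 2 + X 3 + X 4 + X 5) ^ (A 1 - k₂ + A 2) * (X 2 + X 3 + X 4) ^ A 3)) : P6)
        = (X 5 + (X 2 + X 3 + X 4)) ^ (A 1 - k₂ + A 2) *
          (X 2 ^ (U - (m 1 - k₂)) * (X 3 ^ (A 6 - k₁) * (X 2 + X 3 + X 4) ^ A 3)) by ring]
    rw [coeff_X_add_pow_mul (5 : Fin 6) ?_ ?_]
    rotate_left
    · repeat (first
        | with_reducible exact (notMem_vars_X_and (by decide)).1
        | with_reducible apply notMem_vars_mul
        | with_reducible refine (notMem_vars_pow_and ?_ _).1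
        | with_reducible apply notMem_vars_add)
    · repeat (first
        | with_reducible exact (notMem_vars_X_and (by decide)).1
        | with_reducible apply notMem_vars_mul
        | with_reducible refine (notMem_vars_pow_and ?_ _).1
        | with_reducible apply notMem_vars_add)
    have hm5 : ((m.erase 0).erase 1) 5 = m 5 := by simp
    rw [hm5]
    congr 1
    set V := A 1 - k₂ + A 2 - m 5 + A 3 with hV
    rw [show ((X 2 + X 3 + X 4) ^ (A 1 - k₂ + A 2 - m 5) *
        (X 2 ^ (U - (m 1 - k₂)) * (X 3 ^ (A 6 - k₁) * (X 2 + X 3 + X 4) ^ A 3)) : P6)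
        = X 2 ^ (U - (m 1 - k₂)) * ((X 2 + (X 3 + X 4)) ^ V * X 3 ^ (A 6 - k₁)) by rw [hV]; ring]
    rw [coeff_X_pow_mul_X_add_pow_mul (2 : Fin 6) ?_ ?_]
    rotate_left
    · repeat (first
        | with_reducible exact (notMem_vars_X_and (by decide)).1
        | with_reducible apply notMem_vars_mul
        | with_reducible refine (notMem_vars_pow_and ?_ _).1
        | with_reducible apply notMem_vars_add)
    · repeat (first
        | with_reducible exact (notMem_vars_X_and (by decide)).1
        | with_reducible apply notMem_vars_mul
        | with_reducible refine (notMem_vars_pow_and ?_ _).1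
        | with_reducible apply notMem_vars_add)
    have hm2 : (((m.erase 0).erase 1).erase 5) 2 = m 2 := by simp
    rw [hm2]
    by_cases hc2 : U - (m 1 - k₂) ≤ m 2
    · rw [if_pos hc2, if_pos hc2]
      congr 1
      set W := V - (m 2 - (U - (m 1 - k₂))) with hW
      rw [show ((X 3 + X 4) ^ W * X 3 ^ (A 6 - k₁) : P6) = (X 4 + X 3) ^ W * X 3 ^ (A 6 - k₁) by ring]
      rw [coeff_X_add_pow_mul (4 : Fin 6) ?_ ?_]
      rotate_left
      · repeat (first
          | with_reducible exact (notMem_vars_X_and (by decide)).1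
          | with_reducible apply notMem_vars_mul
          | with_reducible refine (notMem_vars_pow_and ?_ _).1
          | with_reducible apply notMem_vars_add)
      · repeat (first
          | with_reducible exact (notMem_vars_X_and (by decide)).1
          | with_reducible apply notMem_vars_mul
          | with_reducible refine (notMem_vars_pow_and ?_ _).1
          | with_reducible apply notMem_vars_add)
      have hm4 : ((((m.erase 0).erase 1).erase 5).erase 2) 4 = m 4 := by simp
      rw [hm4, idx_eq₂]
      congr 1
      rw [← pow_add, coeff_X_pow_single]
    · rw [if_neg hc2, if_neg hc2]
  · rw [if_neg hc, if_neg hc]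

/-- **The closed 2-fold form** of the coefficient of `g^B` in `dualSpanProd A`. -/
def ctSum₂ (A : Fin 8 → ℕ) (B : Fin 6 → ℕ) : ℤ :=
  ∑ k₁ ∈ range (A 6 + 1), ∑ k₂ ∈ range (A 1 + 1), ((A 6).choose k₁ * (A 1).choose k₂ : ℤ) * termCoeff₂ A B k₁ k₂

/-- **`[g^m] dualSpanProd A = ctSum₂ A m`** for every exponent vector `A` and every monomial `m`. -/
theorem coeff_dualSpanProd₂ (A : Fin 8 → ℕ) (m : Fin 6 →₀ ℕ) :
    coeff m (dualSpanProd A) = ctSum₂ A m := by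
  rw [dualSpanProd_eq_sum₂]
  simp only [coeff_sum, coeff_C_mul, coeff_term₂]
  rfl

/-- The same with the monomial given as a function `B : Fin 6 → ℕ`. -/
theorem coeff_dualSpanProd₂' (A : Fin 8 → ℕ) (B : Fin 6 → ℕ) :
    coeff (Finsupp.equivFunOnFinite.symm B) (dualSpanProd A) = ctSum₂ A B := by
  rw [coeff_dualSpanProd₂]
  simp

/-- **Two extraction orders, one coefficient**: cert-2's 3-fold sum `ctSum` equals the 2-fold sum `ctSum₂`
identically in `(A, B)`. -/
theorem ctSum_eq_ctSum₂ (A : Fin 8 → ℕ) (B : Fin 6 → ℕ) : ctSum A B = ctSum₂ A B := by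
  rw [← coeff_dualSpanProd' A B, coeff_dualSpanProd₂']

/-! ## The diagonal: the torus period as a clean DOUBLE sum -/

/-- The summand of the clean double sum: `C(n,k₁)C(n+k₁,n)² · (C(n,k₂)C(n+k₁,n−k₂)C(2n−k₂,n)C(2n−k₂,n−k₁−k₂))`
(meaningful for `k₁ + k₂ ≤ n`). -/
def diagTerm₂ (n k₁ k₂ : ℕ) : ℤ :=
  (n.choose k₁ * (n + k₁).choose n ^ 2 *
    (n.choose k₂ * (n + k₁).choose (n - k₂) * (2 * n - k₂).choose n * (2 * n - k₂).choose (n - k₁ - k₂)) : ℕ)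

/-- On the diagonal the guarded summand `termCoeff₂` is the clean `diagTerm₂` on the triangle `k₁ + k₂ ≤ n` and
vanishes off it (the `g₂`-budget guard). -/
theorem termCoeff₂_diag (n k₁ k₂ : ℕ) (h1 : k₁ ≤ n) (h2 : k₂ ≤ n) :
    (n.choose k₁ * n.choose k₂ : ℤ) * termCoeff₂ (fun _ => n) (fun _ => n) k₁ k₂
      = if k₁ + k₂ ≤ n then diagTerm₂ n k₁ k₂ else 0 := by
  unfold termCoeff₂ diagTerm₂
  simp only
  rw [if_pos h2]
  have eU : k₁ + n - n + n - (n - k₂) = k₁ + k₂ := by omega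
  rw [eU]
  by_cases h3 : k₁ + k₂ ≤ n
  · rw [if_pos h3, if_pos h3]
    have eV : n - k₂ + n - n + n - (n - (k₁ + k₂)) = n + k₁ := by omega
    have eI : n + k₁ - n + (n - k₁) = n := by omega
    rw [eV, eI, if_pos rfl]
    have e1 : k₁ + n - n + n = n + k₁ := by omega
    have e3 : n - k₂ + n - n + n = 2 * n - k₂ := by omega
    have e2 : n - k₂ + n = 2 * n - k₂ := by omega
    have e4 : n - (k₁ + k₂) = n - k₁ - k₂ := by omega
    have e0 : k₁ + n = n + k₁ := by omega
    rw [e1, e3, e2, e4, e0]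
    push_cast
    ring
  · rw [if_neg h3, if_neg h3]
    simp

/-- `numExp (n·1⁸) = (n,…,n)`. -/
theorem numExp_aDiag (n : ℕ) : numExp (SymRay.aDiag n) = fun _ => n := by
  ext i; unfold numExp SymRay.aDiag; rw [bzNum_const]; simp

/-- `gapExp (n·1⁸) = (n,…,n)`. -/
theorem gapExp_aDiag (n : ℕ) : gapExp (SymRay.aDiag n) = fun _ => n := by
  ext w; unfold gapExp SymRay.aDiag; rw [bzDen_const]; simp

/-- **The diagonal torus period as a clean DOUBLE binomial sum**:
`dualConstantTerm (n·1⁸) = Σ_{k₁ ≤ n} Σ_{k₂ ≤ n − k₁} diagTerm₂ n k₁ k₂`. -/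
theorem dualConstantTerm_diag₂ (n : ℕ) :
    dualConstantTerm (SymRay.aDiag n) =
      ∑ k₁ ∈ range (n + 1), ∑ k₂ ∈ range (n - k₁ + 1), diagTerm₂ n k₁ k₂ := by
  rw [dualConstantTerm_eq_ctSum, numExp_aDiag, gapExp_aDiag, ctSum_eq_ctSum₂]
  unfold ctSum₂
  refine Finset.sum_congr rfl fun k₁ hk₁ => ?_
  rw [Finset.mem_range] at hk₁
  have h : ∀ k₂ ∈ range (n + 1), (n.choose k₁ * n.choose k₂ : ℤ) * termCoeff₂ (fun _ => n) (fun _ => n) k₁ k₂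
      = if k₁ + k₂ ≤ n then diagTerm₂ n k₁ k₂ else 0 := fun k₂ hk₂ =>
    termCoeff₂_diag n k₁ k₂ (by omega) (by rw [Finset.mem_range] at hk₂; omega)
  rw [Finset.sum_congr rfl h, ← Finset.sum_filter]
  refine Finset.sum_congr ?_ fun _ _ => rfl
  ext k₂
  simp only [Finset.mem_filter, Finset.mem_range]
  omega

/-- The clean double sum is `Fdiag` (inner sum factored). -/
theorem sum_diagTerm₂_eq_Fdiag (n : ℕ) :
    (∑ k₁ ∈ range (n + 1), ∑ k₂ ∈ range (n - k₁ + 1), diagTerm₂ n k₁ k₂) = (Fdiag n : ℤ) := by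
  unfold Fdiag SA diagTerm₂
  push_cast
  refine Finset.sum_congr rfl fun k₁ _ => ?_
  rw [Finset.mul_sum]

/-- **`dualConstantTerm (n·1⁸) = Fdiag n`** for every `n`. -/
theorem dualConstantTerm_diag_eq_Fdiag (n : ℕ) : dualConstantTerm (SymRay.aDiag n) = (Fdiag n : ℤ) := by
  rw [dualConstantTerm_diag₂, sum_diagTerm₂_eq_Fdiag]

/-- D-exact on the diagonal, `n = 4`: `|Q₄| = 217515501 = CT` (both sides decided; the double sum has 15 terms). -/
theorem dexact_diag_four : |BrownZudilin2022.QOf (SymRay.aDiag 4)| = dualConstantTerm (SymRay.aDiag 4) ∧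
    dualConstantTerm (SymRay.aDiag 4) = 217515501 := by
  rw [SymRay.QOf_diag, dualConstantTerm_diag_eq_Fdiag]
  constructor
  · norm_cast
  · norm_cast

/-- D-exact on the diagonal, `n = 5`: `|Q₅| = 76157194521 = CT`. -/
theorem dexact_diag_five : |BrownZudilin2022.QOf (SymRay.aDiag 5)| = dualConstantTerm (SymRay.aDiag 5) ∧
    dualConstantTerm (SymRay.aDiag 5) = 76157194521 := by
  rw [SymRay.QOf_diag, dualConstantTerm_diag_eq_Fdiag]
  constructor
  · norm_cast
  · norm_cast

/-! ## D-exact on the whole diagonal from ONE single-sum identity -/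

/-- **CONJECTURE D-exact on the WHOLE diagonal follows from the single-sum identity**:
`SingleSumIdentity → ∀ n, |Q(n·1⁸)| = dualConstantTerm (n·1⁸)`. -/
theorem dexact_diag_of_singleSum (h : SingleSumIdentity) (n : ℕ) :
    |BrownZudilin2022.QOf (SymRay.aDiag n)| = dualConstantTerm (SymRay.aDiag n) := by
  rw [SymRay.QOf_diag, dualConstantTerm_diag_eq_Fdiag, Fdiag_eq_of_singleSum h]
  simp

end DualCT

end Summit.KontsevichZagierPeriods.Zeta5Search.Families.Cellular
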